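import Summits.SmoothPoincare4.SmoothPoincare4.Theorems.SullivanDualHyperbolicEndTaubesModelIdentities

/-!
# Route `SullivanDual`, crux `HyperbolicEnd` (stmt-SmoothPoincare4-7825), line `taubes-circle-pencil`:
# the Liouville structure of Taubes' untwisted model

Registered helpers `helper_taubesLiouville_moment` and `helper_taubesForm_liouville` of the checked
skeleton (lead cycle c7): the LIOUVILLE FIELD of Taubes' untwisted near-symplectic model form
`ωT = dt ∧ dQ + ⋆₃ dQ = dt ∧ dQ + dφ ∧ dH` with respect to its primitive `λ_T = −Q dt − H dφ`
(C. H. Taubes, Geom. Topol. 2 (1998) 221–332, §1, eq. (1.10): `Q = ½(a² + b² − 2c²)`,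
`H = c (a² + b²)`, `φ = arg(a + ib)`), in the flat coordinates `y ∈ ℝ⁴` of
`Theorems/SullivanDualHyperbolicEndTaubesModelDefs.lean` (`r = taubesR y`, `a = r − 1`, `b = y₂`,
`c = y₃`, `g = |∇Q| = taubesGrad y`, `g² = a² + b² + 4c²`, `∂_a = (y₀, y₁, 0, 0)/r`, `∂_b = e₂`,
`∂_c = e₃`):

  `X_T = k₁ (a ∂_a + b ∂_b) + k₂ ∂_c`,  `k₁ = (a² + b² + 2c²)/(2g²)`,  `k₂ = 2c³/g²`.

* `helper_taubesLiouville_moment` — the toroidal data of `X_T`: `dt(X_T) = 0`,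
  `a (X_T)₂ − b da(X_T) = 0` (no `∂_φ`-component), `dQ(X_T) = Q`, `dH(X_T) = H` with
  `dH(w) = (a² + b²) w₃ + 2c (a da(w) + b w₂)`;
* `helper_taubesForm_liouville` — `ι_{X_T} ωT = λ_T`:
  `taubesForm y X_T v = −Q dt(v) − c (a v₂ − b da(v))`.

Method (that of the sibling moment-map helper): the toroidal components of `X_T` are
`(dt, da, (·)₂, (·)₃) = (0, k₁ a, k₁ b, k₂)` (`field_simp` + `linear_combination` against
`r² = y₀² + y₁²`, `taubesR_sq`); substituting them into the defining formulas of `taubesDQ` and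
`taubesForm` and clearing the denominators `g²`, `2g²` (`field_simp`, `g > 0`) leaves the two
polynomial identities `(a² + b²)(a² + b² + 2c²) − 8c⁴ = (a² + b² + 4c²)(a² + b² − 2c²)` and
`2c³ + c (a² + b² + 2c²) = c (a² + b² + 4c²)`, i.e. `linear_combination` against
`g² = a² + b² + 4c²` (`taubesGrad_sq`).  Positivity of `r` and `g` are hypotheses here (on a
punctured tube of radius `< 1` they are `helper_taubesR_pos`, `helper_taubesGrad_pos`).  Nothing
about `J♭` or the closedness of `ωT` is in this file.
-/

-- the registered namespace `Summit.SmoothPoincare4.SmoothPoincare4.…` repeats a component (P = Sub)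
set_option linter.dupNamespace false

noncomputable section

namespace Summit.SmoothPoincare4.SmoothPoincare4.Cruxes.HyperbolicEnd.TaubesCirclePencil

/-- `taubesForm y u v` expressed through the toroidal components `dt(u)`, `da(u)`, `u₂`, `u₃` of its
first argument: the defining formula of `ωT` with these four numbers substituted. [folklore] -/
private theorem liouville_taubesForm_of_components (y u v : EuclideanSpace ℝ (Fin 4))
    (t r u2 u3 : ℝ) (h0 : taubesDt y u = t) (h1 : taubesDa y u = r) (h2 : u 2 = u2)
    (h3 : u 3 = u3) :
    taubesForm y u v =
      t * taubesDQ y v - taubesDt y v * ((taubesR y - 1) * r + y 2 * u2 - 2 * y 3 * u3)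
        + (taubesR y - 1) * (u2 * v 3 - v 2 * u3)
        + y 2 * (u3 * taubesDa y v - v 3 * r)
        - 2 * y 3 * (r * v 2 - taubesDa y v * u2) := by
  subst h0 h1 h2 h3
  rfl

/-- Flat components of `k₁ (a ∂_a + b ∂_b) + k₂ ∂_c` with `∂_a = (y₀, y₁, 0, 0)/r`, `∂_b = e₂`,
`∂_c = e₃`: `(k₁ a y₀/r, k₁ a y₁/r, k₁ b, k₂)`. [folklore] -/
private theorem liouville_flat_components (y : EuclideanSpace ℝ (Fin 4)) (k₁ k₂ : ℝ) :
    (k₁ • ((taubesR y - 1) • WithLp.toLp 2 ![y 0 / taubesR y, y 1 / taubesR y, 0, 0]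
        + y 2 • EuclideanSpace.single (2 : Fin 4) (1 : ℝ))
        + k₂ • EuclideanSpace.single (3 : Fin 4) (1 : ℝ) : EuclideanSpace ℝ (Fin 4)) 0 =
      k₁ * ((taubesR y - 1) * (y 0 / taubesR y)) ∧
    (k₁ • ((taubesR y - 1) • WithLp.toLp 2 ![y 0 / taubesR y, y 1 / taubesR y, 0, 0]
        + y 2 • EuclideanSpace.single (2 : Fin 4) (1 : ℝ))
        + k₂ • EuclideanSpace.single (3 : Fin 4) (1 : ℝ) : EuclideanSpace ℝ (Fin 4)) 1 =
      k₁ * ((taubesR y - 1) * (y 1 / taubesR y)) ∧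
    (k₁ • ((taubesR y - 1) • WithLp.toLp 2 ![y 0 / taubesR y, y 1 / taubesR y, 0, 0]
        + y 2 • EuclideanSpace.single (2 : Fin 4) (1 : ℝ))
        + k₂ • EuclideanSpace.single (3 : Fin 4) (1 : ℝ) : EuclideanSpace ℝ (Fin 4)) 2 =
      k₁ * y 2 ∧
    (k₁ • ((taubesR y - 1) • WithLp.toLp 2 ![y 0 / taubesR y, y 1 / taubesR y, 0, 0]
        + y 2 • EuclideanSpace.single (2 : Fin 4) (1 : ℝ))
        + k₂ • EuclideanSpace.single (3 : Fin 4) (1 : ℝ) : EuclideanSpace ℝ (Fin 4)) 3 = k₂ := by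
  refine ⟨?_, ?_, ?_, ?_⟩
  · simp [Matrix.cons_val_zero]
  · simp [Matrix.cons_val_one]
  · simp [Matrix.cons_val]
  · simp [Matrix.cons_val]

/-- Toroidal components of `X = k₁ (a ∂_a + b ∂_b) + k₂ ∂_c` off the axis: `dt(X) = 0`,
`da(X) = k₁ a`, `X₂ = k₁ b`, `X₃ = k₂`. [folklore] -/
private theorem liouville_components (y : EuclideanSpace ℝ (Fin 4)) (hr : 0 < taubesR y)
    (k₁ k₂ : ℝ) :
    taubesDt y (k₁ • ((taubesR y - 1) • WithLp.toLp 2 ![y 0 / taubesR y, y 1 / taubesR y, 0, 0]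
        + y 2 • EuclideanSpace.single (2 : Fin 4) (1 : ℝ))
        + k₂ • EuclideanSpace.single (3 : Fin 4) (1 : ℝ)) = 0 ∧
    taubesDa y (k₁ • ((taubesR y - 1) • WithLp.toLp 2 ![y 0 / taubesR y, y 1 / taubesR y, 0, 0]
        + y 2 • EuclideanSpace.single (2 : Fin 4) (1 : ℝ))
        + k₂ • EuclideanSpace.single (3 : Fin 4) (1 : ℝ)) = k₁ * (taubesR y - 1) ∧
    (k₁ • ((taubesR y - 1) • WithLp.toLp 2 ![y 0 / taubesR y, y 1 / taubesR y, 0, 0]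
        + y 2 • EuclideanSpace.single (2 : Fin 4) (1 : ℝ))
        + k₂ • EuclideanSpace.single (3 : Fin 4) (1 : ℝ) : EuclideanSpace ℝ (Fin 4)) 2 =
      k₁ * y 2 ∧
    (k₁ • ((taubesR y - 1) • WithLp.toLp 2 ![y 0 / taubesR y, y 1 / taubesR y, 0, 0]
        + y 2 • EuclideanSpace.single (2 : Fin 4) (1 : ℝ))
        + k₂ • EuclideanSpace.single (3 : Fin 4) (1 : ℝ) : EuclideanSpace ℝ (Fin 4)) 3 = k₂ := by
  have hr0 : taubesR y ≠ 0 := hr.ne'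
  have hsq := taubesR_sq y
  obtain ⟨e0, e1, e2, e3⟩ := liouville_flat_components y k₁ k₂
  refine ⟨?_, ?_, e2, e3⟩
  · rw [taubesDt, e0, e1]
    ring
  · rw [taubesDa, e0, e1]
    field_simp
    linear_combination (-(k₁ * (taubesR y - 1))) * hsq

/-- **The Liouville field of Taubes' untwisted model, toroidal data** (Taubes 1998, §1, eq. (1.10):
`ωT = dt ∧ dQ + dφ ∧ dH`, `Q = ½(a² + b² − 2c²)`, `H = c (a² + b²)`).  For
`X = X_T = k₁ (a ∂_a + b ∂_b) + k₂ ∂_c`, `k₁ = (a² + b² + 2c²)/(2g²)`, `k₂ = 2c³/g²`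
(`g² = a² + b² + 4c²`), off the axis and off the core: `dt(X) = 0`, `a X₂ − b da(X) = 0` (no
`∂_φ`-component), `dQ(X) = Q` and `dH(X) = (a² + b²) X₃ + 2c (a da(X) + b X₂) = H = c (a² + b²)`.
[folklore] -/
theorem helper_taubesLiouville_moment : ∀ (y X : EuclideanSpace ℝ (Fin 4)), 0 < taubesR y → 0 < taubesGrad y → X = (((taubesR y - 1) ^ 2 + y 2 ^ 2 + 2 * y 3 ^ 2) / (2 * taubesGrad y ^ 2)) • ((taubesR y - 1) • WithLp.toLp 2 ![y 0 / taubesR y, y 1 / taubesR y, 0, 0] + y 2 • EuclideanSpace.single (2 : Fin 4) (1 : ℝ)) + (2 * y 3 ^ 3 / taubesGrad y ^ 2) • EuclideanSpace.single (3 : Fin 4) (1 : ℝ) → taubesDt y X = 0 ∧ (taubesR y - 1) * X 2 - y 2 * taubesDa y X = 0 ∧ taubesDQ y X = ((taubesR y - 1) ^ 2 + y 2 ^ 2 - 2 * y 3 ^ 2) / 2 ∧ ((taubesR y - 1) ^ 2 + y 2 ^ 2) * X 3 + 2 * y 3 * ((taubesR y - 1) * taubesDa y X + y 2 * X 2) =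 y 3 * ((taubesR y - 1) ^ 2 + y 2 ^ 2) := by
  intro y X hr hg hX
  have hgsq := taubesGrad_sq y
  have hg0 : taubesGrad y ≠ 0 := hg.ne'
  obtain ⟨h0, h1, h2, h3⟩ := liouville_components y hr
    (((taubesR y - 1) ^ 2 + y 2 ^ 2 + 2 * y 3 ^ 2) / (2 * taubesGrad y ^ 2))
    (2 * y 3 ^ 3 / taubesGrad y ^ 2)
  rw [← hX] at h0 h1 h2 h3
  refine ⟨h0, ?_, ?_, ?_⟩
  · rw [h1, h2]
    ring
  · rw [taubesDQ, h1, h2, h3]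
    field_simp
    linear_combination (-((taubesR y - 1) ^ 2 + y 2 ^ 2 - 2 * y 3 ^ 2)) * hgsq
  · rw [h1, h2, h3]
    field_simp
    linear_combination (-(((taubesR y - 1) ^ 2 + y 2 ^ 2) * y 3)) * hgsq

/-- **`ι_{X_T} ωT = λ_T`: the Liouville structure of Taubes' untwisted model** (Taubes 1998, §1,
eq. (1.10): `ωT = dt ∧ dQ + dφ ∧ dH = dλ_T`, `λ_T = −Q dt − H dφ`, `H dφ = c (a db − b da)`).  For the
field `X = X_T = k₁ (a ∂_a + b ∂_b) + k₂ ∂_c`, `k₁ = (a² + b² + 2c²)/(2g²)`, `k₂ = 2c³/g²`, off the axis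
and off the core: `taubesForm y X v = −Q dt(v) − c (a v₂ − b da(v))` for every flat vector `v`
(so `L_{X_T} ωT = ωT`: `X_T` is the Liouville field of `(ωT, λ_T)`). [folklore] -/
theorem helper_taubesForm_liouville : ∀ (y X : EuclideanSpace ℝ (Fin 4)), 0 < taubesR y → 0 < taubesGrad y → X = (((taubesR y - 1) ^ 2 + y 2 ^ 2 + 2 * y 3 ^ 2) / (2 * taubesGrad y ^ 2)) • ((taubesR y - 1) • WithLp.toLp 2 ![y 0 / taubesR y, y 1 / taubesR y, 0, 0] + y 2 • EuclideanSpace.single (2 : Fin 4) (1 : ℝ)) + (2 * y 3 ^ 3 / taubesGrad y ^ 2) • EuclideanSpace.single (3 : Fin 4) (1 : ℝ) → ∀ v : EuclideanSpace ℝ (Fin 4), taubesForm y X v = -(((taubesR y - 1) ^ 2 + y 2 ^ 2 - 2 * y 3 ^ 2) / 2) * taubesDt y v - y 3 * ((taubesR y - 1) * v 2 - y 2 * taubesDa y v) := by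
  intro y X hr hg hX v
  have hgsq := taubesGrad_sq y
  have hg0 : taubesGrad y ≠ 0 := hg.ne'
  obtain ⟨h0, h1, h2, h3⟩ := liouville_components y hr
    (((taubesR y - 1) ^ 2 + y 2 ^ 2 + 2 * y 3 ^ 2) / (2 * taubesGrad y ^ 2))
    (2 * y 3 ^ 3 / taubesGrad y ^ 2)
  rw [← hX] at h0 h1 h2 h3
  rw [liouville_taubesForm_of_components y X v _ _ _ _ h0 h1 h2 h3]
  field_simp
  linear_combination (taubesDt y v * ((taubesR y - 1) ^ 2 + y 2 ^ 2 - 2 * y 3 ^ 2)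
    + 2 * y 3 * ((taubesR y - 1) * v 2 - y 2 * taubesDa y v)) * hgsq

end Summit.SmoothPoincare4.SmoothPoincare4.Cruxes.HyperbolicEnd.TaubesCirclePencil

end
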